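import Summits.CriticalPhenomena.PercolationContinuityZ3.Theorems.PercNearOneGluingNoHeavyQuantFlowUncross
import HarnessLib

/-!
# QUANT lane R8, T-DEC, leg (III): FULL `SingleGateConvClosed` programme — the residual-mids step (rule R3)

builds on p205010 (kernel theorem, internal audit signed; external expert review pending)

Support file (`--supports stmt-CriticalPhenomena-4575`), QUANT lane seat prim-quant-arm-2 (gen 37), rung R8 of
`run/shared/lean/prim/quant/LADDER.md`.  One theorem, standard axioms, no sorries.  Memo `…/prim-quant-arm-2-g37/L2-TRANSPORT-G37.md` §9b–§10
(rule R3; exact census 0 / 984 848 layers together with the two families, the pooled slots and the combined remainder criterion; lead V355).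
After the shifted mid pairs and the pooled slots, the remaining nonzero lows `t` (masses `ℓ t`) are shipped into the mids `k` that still have
residual capacity `A k`, by the closed-form CAPACITY-PROPORTIONAL rule
`ψ t k = (A k / usage(t,k)) · min(ℓ t / E k, ℓ t / C t)` on the ELIGIBLE pairs (`t` a nonzero low, `k ≤ j` a compatible mid above `t`, and the
arc no more expensive than a giant: `usage(t,k) ≤ y/(1−y)`), where `E k = Σ_{t eligible at k} ℓ t` and `C t = Σ_{k eligible for t} A k / usage(t,k)`.
Columns add up to at most `A k`, rows to at most `ℓ t`, and a row is shipped ENTIRELY as soon as `E k ≤ C t` for every `k` eligible for it.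

* **`LawDec.residualMids_R3`**.

[this work].  Rows served [cite: KozmaNitzan2024, Conjecture 3 (p. 15)]; [cite: Grimmett1999, §1.3 p. 10].
-/

noncomputable section

namespace Summit.CriticalPhenomena.PercolationContinuityZ3.Theorems

namespace Quant

open Finset

namespace LawDec

/-- **RULE R3 (residual mids, capacity-proportional).**  See the file header. [this work] -/
theorem residualMids_R3 (y S' : ℝ) (j M : ℕ) (A ℓ : ℕ → ℝ) (hy0 : 0 < y) (hy1 : y < 1) (hjM : j ≤ M)
    (hA0 : ∀ k, 0 ≤ A k) (hℓ0 : ∀ t, 0 ≤ ℓ t) :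
    ∃ ψ : ℕ → ℕ → ℝ,
      (∀ t k, 0 ≤ ψ t k) ∧
      (∀ t k, 0 < ψ t k → (1 ≤ t ∧ t ≤ j ∧ 2 * (t : ℝ) < S') ∧ t < k ∧ k ≤ j ∧ S' < (t : ℝ) + k ∧
        usage y S' j t k ≤ y / (1 - y)) ∧
      (∀ k, ∑ t ∈ Finset.range (j + 1), usage y S' j t k * ψ t k ≤ A k) ∧
      (∀ t, ∑ k ∈ Finset.range (M + 1), ψ t k ≤ ℓ t) ∧
      (∀ t, (1 ≤ t ∧ t ≤ j ∧ 2 * (t : ℝ) < S') →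
        0 < ∑ k ∈ Finset.range (j + 1), (if (t < k ∧ k ≤ j ∧ S' < (t : ℝ) + k ∧ usage y S' j t k ≤ y / (1 - y))
              then A k / usage y S' j t k else 0) →
        (∀ k, (t < k ∧ k ≤ j ∧ S' < (t : ℝ) + k ∧ usage y S' j t k ≤ y / (1 - y)) →
          ∑ t' ∈ Finset.range (j + 1), (if ((1 ≤ t' ∧ t' ≤ j ∧ 2 * (t' : ℝ) < S') ∧ (t' < k ∧ k ≤ j ∧ S' < (t' : ℝ) + k ∧
              usage y S' j t' k ≤ y / (1 - y))) then ℓ t' else 0)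
          ≤ ∑ k' ∈ Finset.range (j + 1), (if (t < k' ∧ k' ≤ j ∧ S' < (t : ℝ) + k' ∧ usage y S' j t k' ≤ y / (1 - y))
              then A k' / usage y S' j t k' else 0)) →
        ∑ k ∈ Finset.range (M + 1), ψ t k = ℓ t) := by
  classical
  -- eligibility, the column masses `E`, the row capacities `C`
  set P : ℕ → Prop := fun t => 1 ≤ t ∧ t ≤ j ∧ 2 * (t : ℝ) < S' with hP
  set Q : ℕ → ℕ → Prop := fun t k => t < k ∧ k ≤ j ∧ S' < (t : ℝ) + k ∧ usage y S' j t k ≤ y / (1 - y) with hQ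
  set E : ℕ → ℝ := fun k => ∑ t' ∈ Finset.range (j + 1), (if (P t' ∧ Q t' k) then ℓ t' else 0) with hE
  set C : ℕ → ℝ := fun t => ∑ k' ∈ Finset.range (j + 1), (if Q t k' then A k' / usage y S' j t k' else 0) with hC
  set ψ : ℕ → ℕ → ℝ := fun t k =>
    if (P t ∧ Q t k) then A k / usage y S' j t k * min (ℓ t / E k) (ℓ t / C t) else 0 with hψ
  have hupos : ∀ t k, P t → Q t k → 0 < usage y S' j t k := fun t k ht hq =>
    usage_pos_of_compat y S' j t k hy0 hy1 ht.2.2 hq.1 (Or.inr hq.2.2.1)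
  have hE0 : ∀ k, 0 ≤ E k := fun k => Finset.sum_nonneg fun t' _ => by split_ifs; exacts [hℓ0 t', le_rfl]
  have hCterm0 : ∀ t k', P t → 0 ≤ (if Q t k' then A k' / usage y S' j t k' else 0) := by
    intro t k' ht; split_ifs with h
    · exact div_nonneg (hA0 k') (hupos t k' ht h).le
    · exact le_rfl
  have hC0 : ∀ t, P t → 0 ≤ C t := fun t ht => Finset.sum_nonneg fun k' _ => hCterm0 t k' ht
  -- an eligible row sits inside the column mass
  have hℓE : ∀ t k, P t → Q t k → ℓ t ≤ E k := by
    intro t k ht hq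
    have hmem : t ∈ Finset.range (j + 1) := Finset.mem_range.2 (by have := ht.2.1; omega)
    have := Finset.single_le_sum (f := fun t' => if (P t' ∧ Q t' k) then ℓ t' else 0)
      (fun t' _ => by split_ifs; exacts [hℓ0 t', le_rfl]) hmem
    simp only [if_pos (And.intro ht hq)] at this
    exact this
  have hmin0 : ∀ t k, P t → 0 ≤ min (ℓ t / E k) (ℓ t / C t) := fun t k ht =>
    le_min (div_nonneg (hℓ0 t) (hE0 k)) (div_nonneg (hℓ0 t) (hC0 t ht))
  have hψ0 : ∀ t k, 0 ≤ ψ t k := by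
    intro t k; simp only [hψ]
    split_ifs with h
    · exact mul_nonneg (div_nonneg (hA0 k) (hupos t k h.1 h.2).le) (hmin0 t k h.1)
    · exact le_rfl
  have hψz : ∀ t k, ¬ (P t ∧ Q t k) → ψ t k = 0 := fun t k h => by simp only [hψ]; rw [if_neg h]
  refine ⟨ψ, hψ0, ?_, ?_, ?_, ?_⟩
  · -- support
    intro t k hp
    by_cases h : P t ∧ Q t k
    · exact ⟨h.1, h.2.1, h.2.2.1, h.2.2.2.1, h.2.2.2.2⟩
    · rw [hψz t k h] at hp; exact absurd hp (lt_irrefl 0)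
  · -- columns
    intro k
    have hle : ∀ t ∈ Finset.range (j + 1), usage y S' j t k * ψ t k ≤ (if (P t ∧ Q t k) then ℓ t else 0) * (A k / E k) := by
      intro t _
      by_cases h : P t ∧ Q t k
      · simp only [hψ]; rw [if_pos h, if_pos h]
        have hu := hupos t k h.1 h.2
        calc usage y S' j t k * (A k / usage y S' j t k * min (ℓ t / E k) (ℓ t / C t))
            = A k * min (ℓ t / E k) (ℓ t / C t) := by field_simp
          _ ≤ A k * (ℓ t / E k) := mul_le_mul_of_nonneg_left (min_le_left _ _) (hA0 k)
          _ = ℓ t * (A k / E k) := by ring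
      · rw [hψz t k h, if_neg h]; simp
    refine le_trans (Finset.sum_le_sum hle) ?_
    rw [← Finset.sum_mul]
    change E k * (A k / E k) ≤ A k
    rcases (hE0 k).eq_or_lt with hz | hpos
    · rw [← hz]; simp [hA0 k]
    · rw [mul_div_cancel₀ _ (ne_of_gt hpos)]
  · -- rows
    intro t
    by_cases ht : P t
    · have hle : ∀ k ∈ Finset.range (M + 1), ψ t k ≤ (if Q t k then A k / usage y S' j t k else 0) * (ℓ t / C t) := by
        intro k _
        by_cases h : Q t k
        · simp only [hψ]; rw [if_pos ⟨ht, h⟩, if_pos h]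
          exact mul_le_mul_of_nonneg_left (min_le_right _ _) (div_nonneg (hA0 k) (hupos t k ht h).le)
        · rw [hψz t k (fun hc => h hc.2), if_neg h]; simp
      refine le_trans (Finset.sum_le_sum hle) ?_
      rw [← Finset.sum_mul]
      -- the sum over `range (M+1)` is the sum over `range (j+1)` (`Q t k` forces `k ≤ j`)
      have hres : ∑ k ∈ Finset.range (M + 1), (if Q t k then A k / usage y S' j t k else 0) = C t := by
        symm
        refine Finset.sum_subset (fun x hx => by rw [Finset.mem_range] at hx ⊢; omega) ?_
        intro k _ hk
        rw [Finset.mem_range] at hk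
        rw [if_neg (fun hc => hk (by have := hc.2.1; omega))]
      rw [hres]
      rcases (hC0 t ht).eq_or_lt with hz | hpos
      · rw [← hz]; simp [hℓ0 t]
      · rw [mul_div_cancel₀ _ (ne_of_gt hpos)]
    · have : ∀ k ∈ Finset.range (M + 1), ψ t k = 0 := fun k _ => hψz t k (fun hc => ht hc.1)
      rw [Finset.sum_eq_zero this]; exact hℓ0 t
  · -- a row is shipped entirely when every eligible column's mass fits the row capacity
    intro t ht hCpos hEC
    have hterm : ∀ k ∈ Finset.range (M + 1), ψ t k = (if Q t k then A k / usage y S' j t k else 0) * (ℓ t / C t) := by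
      intro k _
      by_cases h : Q t k
      · simp only [hψ]; rw [if_pos ⟨ht, h⟩, if_pos h]
        congr 1
        -- `min (ℓ/E) (ℓ/C) = ℓ/C` since `ℓ t ≤ E k ≤ C t`
        rcases (hℓ0 t).eq_or_lt with hz | hℓpos
        · rw [← hz]; simp
        · have hEk : 0 < E k := lt_of_lt_of_le hℓpos (hℓE t k ht h)
          have hEC' : E k ≤ C t := by simpa only [hE, hC] using hEC k h
          exact min_eq_right (div_le_div_of_nonneg_left (hℓ0 t) hEk hEC')
      · rw [hψz t k (fun hc => h hc.2), if_neg h]; simp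
    rw [Finset.sum_congr rfl hterm, ← Finset.sum_mul]
    have hres : ∑ k ∈ Finset.range (M + 1), (if Q t k then A k / usage y S' j t k else 0) = C t := by
      symm
      refine Finset.sum_subset (fun x hx => by rw [Finset.mem_range] at hx ⊢; omega) ?_
      intro k _ hk
      rw [Finset.mem_range] at hk
      rw [if_neg (fun hc => hk (by have := hc.2.1; omega))]
    rw [hres, mul_div_cancel₀ _ (ne_of_gt hCpos)]

end LawDec

end Quant

end Summit.CriticalPhenomena.PercolationContinuityZ3.Theorems
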